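import Summits.BirchSwinnertonDyer.BirchSwinnertonDyer.Theorems.ByReductionTypeAtTwoSupersingularFlatCountTwoOfPrintV7
import Summits.BirchSwinnertonDyer.BirchSwinnertonDyer.Theorems.PublishedInputsGreenbergSigmaDivAnyTorsion
import Summits.BirchSwinnertonDyer.BirchSwinnertonDyer.Theorems.PublishedInputsGreenbergControlAtTwoOfFour
import HarnessLib

/-!
# COUNT♭@2 door WITHOUT named facts: Greenberg's Prop. 4.12, the pp. 119–120 corank count and §5 p. 140
# (Kato Thm. 12.4) are BYPASSED — their only use, «`H¹(ℚ_Σ/ℚ_∞, E[2^∞])_Γ = 0`», is a tree theorem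

Seat `bsd-inputs-k4-p1` GEN 7 (LADDER-BSD D-0154 KEY (147)(f) «prove the printed input»: the cite-only Greenberg
LNM 1716 facts consumed at rung K4), `--supports stmt-BirchSwinnertonDyer-20309`. THEOREMS ONLY.

THE POINT. Door v7 of the crux `SupersingularRankZeroAtTwo` (item 19097, line `flat_uniform_two`, conjunct
COUNT♭@2; `SSFlatEC.flatCountTwo_of_print4`) derives the COUNT♭@2 clause of `stub_allFlatData` from the Honda₂
clauses and FOUR named facts of [GreenbergLNM1716] taken as hypotheses: Prop. 4.13 (Cassels, `hC`), Prop. 4.12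
(`h412`), the corank count pp. 119–120 (`hcork`) and §5 p. 140 = Kato Thm. 12.4 (`hWL`, weak Leopoldt). In that
door `h412`, `hcork`, `hWL` (and the dual datum of `H = H¹(ℚ_Σ/ℚ_∞, E[2^∞])`) serve ONE purpose: Greenberg's
p. 119 deduction «no proper finite-index `Λ`-submodule (Prop. 4.12 under corank `1` = Kato) ∧ `H_Γ` finite
(pp. 119–120) ⇒ `H_Γ = 0`», i.e. «DIV in `H`»: every `s ∈ H` is `conj_γ t − t` with `t ∈ H`. But «DIV in `H`»
in the regime of the door (`Sel_{2^∞}(E/ℚ)` finite — it is the antecedent of the COUNT♭@2 clause) is a THEOREM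
of the tree with no `Λ`-module input at all:
`InputsGreenbergSigmaDivAnyTorsion.forall_exists_conjH1_sub_eq_unramifiedOutside_real` (this seat, from
`Ш²(ℚ, E[2^∞]) = 0` ⇒ DIV for `H¹(ℚ_∞, E[2^∞])` ⇒ descent to `H¹(ℚ_Σ/ℚ_∞, E[2^∞])` by Cassels-away-from-one-place;
totally real base, every `p`, any rational torsion). And Prop. 4.13 over `ℚ` is the tree theorem
`InputsPoitouTateSelmer.casselsSurjectivity_H1Sigma_holds ℚ`; p. 108 is
`Greenberg1999.localQuotient_restriction_surjective_holds` (already used by v7).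

WHAT IS PROVED (namespace `…Theorems.InputsGreenbergFlatCountTwo`):
* §1 `sharpFlatEndCoinvariants_subsingleton_of_cassels_top_of_div` — any number field `K`, prime `p`,
  cyclotomic `κ`, topological generator `γ`, colour: «DIV in `H¹(K_Σ/K_∞, E[p^∞])`» ∧ CASSELS at level `Γ_K`
  ∧ the local lifts at the finite places of `Σ` ⇒ `(Sel^•(E/K_∞))_γ = 0` (= `SSFlatEC.…_of_cassels_top` with
  its dual-datum hypotheses `(Y, dY, hbij, hT, hC, hY, hfin)` replaced by the single hypothesis «DIV in `H`»);
  `…_of_cassels_top_real` / `_odd` / `_complex`: the same with «DIV in `H`» DISCHARGED (`Sel_{p^∞}(E/K)` finite;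
  `K` totally real — every `p` / any `K` — odd `p` / `K` totally complex — every `p`).
* §2 `flatCountTwo_noPrint` — **door v8: the COUNT♭@2 clause of `stub_allFlatData` from the Honda₂ clauses
  ALONE** — the statement of `SSFlatEC.flatCountTwo_of_print4` with its four named-fact binders deleted.
HONEST TAG of COUNT♭@2 after this file: THEOREM (no PRINT-by-name binder, no displayed input). Nothing about
any curve is asserted; the crux 19097 is not closed by this (its other conjuncts / stubs are untouched); no
census cell moves; no summit statement is proved; BSD is NOT proved by any of this.

References: [GreenbergLNM1716] §4 Thm. 4.1, Lemma 4.7 (pp. 107–108), Prop. 4.8 (p. 109), p. 119, Prop. 4.12,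
Prop. 4.13 / p. 122; [MilneADT2006] I Thm. 4.10; [Sprung2012] §7.
-/

set_option autoImplicit false
-- the Theorems namespace of this sub repeats the summit name by design (D-0017 nested layout)
set_option linter.dupNamespace false

noncomputable section

open scoped Classical NumberField

open NumberField IsDedekindDomain WeierstrassCurve Literature.NumberTheory.EllipticCurves
  Literature.NumberTheory.GaloisRepresentations Literature.NumberTheory.EllipticCurves.ZpExtension
  Literature.NumberTheory.EllipticCurves.Kobayashi2003 Literature.NumberTheory.EllipticCurves.Sprung2017
  Literature.NumberTheory.EllipticCurves.Sprung2012 Literature.NumberTheory.EllipticCurves.Sprung2024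
  Literature.NumberTheory.EllipticCurves.IwasawaDual Literature.NumberTheory.EllipticCurves.IwasawaAlgebra
  Literature.NumberTheory.EllipticCurves.GreenbergVatsal2000 Literature.NumberTheory.EllipticCurves.Rank1Residual
  Summit.BirchSwinnertonDyer.Rank1Residual.X5.O1
  Summit.BirchSwinnertonDyer.BirchSwinnertonDyer.Theorems.SSFlatEC

namespace Summit.BirchSwinnertonDyer.BirchSwinnertonDyer.Theorems.InputsGreenbergFlatCountTwo

/-! ## §1 `(Sel^•(E/K_∞))_γ = 0` from «DIV in `H¹(K_Σ/K_∞, E[p^∞])`», Cassels and the local lifts -/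

section Assembly

-- `K : Type` (universe `0`), as in `SSFlatEC.sharpFlatEndCoinvariants_subsingleton_of_cassels_top`.
variable {K : Type} [Field K] [NumberField K] (W : WeierstrassCurve K) [W.IsElliptic] {p : ℕ}
  [Fact p.Prime] (κ : ZpExtension K p) {v₀ : HeightOneSpectrum (𝓞 K)} (ap : ℤ)
  (g : Field.absoluteGaloisGroup (v₀.adicCompletion K)) (c : ℕ → localPoints W (v₀.adicCompletion K))
  (col : Chroma)

/-- **`(Sel^•(E/K_∞))_γ = 0` from «DIV in `H = H¹(K_Σ/K_∞, E[p^∞])`», CASSELS at level `Γ_K`, and the local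
lifts at the finite places of `Σ`** (cyclotomic `κ`, topological generator `γ`, `v₀ ∋ p` the place of the
`•`-data, `Sel^• ⊆ H`). This is `SSFlatEC.sharpFlatEndCoinvariants_subsingleton_of_cassels_top` with Greenberg's
(a) ∧ (b) on a dual datum of `H` replaced by their consequence «DIV in `H`» (hypothesis `hdiv`), run through the
ambient chase `SSFlatEC.sharpFlatEndCoinvariants_subsingleton_of_ambient` with the invariant class `res y` of
`SSFlatEC.exists_sub_resOfLe_mem_sharpFlatSelmerInfty_of_cassels_top`.
[cite: GreenbergLNM1716, §4 Lemma 4.7 (pp. 107–108), Prop. 4.8 (p. 109), p. 119, p. 122] -/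
theorem sharpFlatEndCoinvariants_subsingleton_of_cassels_top_of_div (hκ : κ.IsCyclotomic)
    {γ : Field.absoluteGaloisGroup K} (hγ : κ.IsTopGenerator γ) (S₀ : Set (HeightOneSpectrum (𝓞 K)))
    (hgood : ∀ v : HeightOneSpectrum (𝓞 K), v ∉ S₀ → ((p : ℕ) : 𝓞 K) ∉ v.asIdeal →
      W.HasGoodReductionAt v)
    (hv₀ : ((p : ℕ) : 𝓞 K) ∈ v₀.asIdeal)
    (hle : sharpFlatSelmerInfty W κ (closureEmb (K := K) (v₀.adicCompletion K)) ap g c col ≤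
      unramifiedOutside κ.kerSubgroup (W.geomPrimaryTorsion p) p S₀)
    (hdiv : ∀ s ∈ unramifiedOutside κ.kerSubgroup (W.geomPrimaryTorsion p) p S₀,
      ∃ t ∈ unramifiedOutside κ.kerSubgroup (W.geomPrimaryTorsion p) p S₀, W.conjH1 p κ.kerSubgroup γ t - t = s)
    (hCas : ∀ (x : ∀ v : HeightOneSpectrum (𝓞 K),
        discreteH1 (localSubgroup (⊤ : Subgroup (Field.absoluteGaloisGroup K)) (v.adicCompletion K))
          (localPoints W (v.adicCompletion K)))
      (xi : ∀ w : InfinitePlace K,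
        discreteH1 (localSubgroup (⊤ : Subgroup (Field.absoluteGaloisGroup K)) w.Completion)
          (localPoints W w.Completion)),
      (∀ v, ∃ k : ℕ, p ^ k • x v = 0) → (∀ w, ∃ k : ℕ, p ^ k • xi w = 0) →
      ∃ y : W.subgroupH1 p (⊤ : Subgroup (Field.absoluteGaloisGroup K)),
        y ∈ unramifiedOutside (⊤ : Subgroup (Field.absoluteGaloisGroup K)) (W.geomPrimaryTorsion p) p S₀ ∧
        (∀ v, (v ∈ S₀ ∨ ((p : ℕ) : 𝓞 K) ∈ v.asIdeal) →
          W.localResOver p ⊤ (v.adicCompletion K) y = x v) ∧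
        (∀ w, W.localResOver p ⊤ w.Completion y = xi w))
    (hloc : ∀ t ∈ unramifiedOutside κ.kerSubgroup (W.geomPrimaryTorsion p) p S₀,
      (∀ σ : Field.absoluteGaloisGroup K, W.conjH1 p κ.kerSubgroup σ t - t ∈
        sharpFlatSelmerInfty W κ (closureEmb (K := K) (v₀.adicCompletion K)) ap g c col) →
      ∀ v : HeightOneSpectrum (𝓞 K), (v ∈ S₀ ∨ ((p : ℕ) : 𝓞 K) ∈ v.asIdeal) →
      ∃ xv : discreteH1 (localSubgroup (⊤ : Subgroup (Field.absoluteGaloisGroup K)) (v.adicCompletion K))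
          (localPoints W (v.adicCompletion K)),
        (∃ k : ℕ, p ^ k • xv = 0) ∧
        ∀ y : W.subgroupH1 p (⊤ : Subgroup (Field.absoluteGaloisGroup K)),
          W.localResOver p ⊤ (v.adicCompletion K) y = xv →
          t - W.resOfLe p (le_top : κ.kerSubgroup ≤ ⊤) y ∈
              W.localKerOver p κ.kerSubgroup (v.adicCompletion K) ∧
          (v = v₀ → t - W.resOfLe p (le_top : κ.kerSubgroup ≤ ⊤) y ∈
            sharpFlatLocalKummerOverOfEmb W p κ.kerSubgroup (closureEmb (K := K) (v₀.adicCompletion K))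
              (localTowerPointsOfEmb κ (closureEmb (K := K) (v₀.adicCompletion K)) W)
              (colemanKer κ (closureEmb (K := K) (v₀.adicCompletion K)) W ap g c col))) :
    Subsingleton (EndCoinvariants
      (conjSharpFlatSelmerInfty W κ (closureEmb (K := K) (v₀.adicCompletion K)) ap g c col γ - 1)) := by
  refine sharpFlatEndCoinvariants_subsingleton_of_ambient W κ (closureEmb (K := K) (v₀.adicCompletion K)) ap
    g c col γ (unramifiedOutside κ.kerSubgroup (W.geomPrimaryTorsion p) p S₀) (fun s hs ↦ hdiv s (hle hs))
    fun t htH htγ ↦ ?_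
  have htall : ∀ σ : Field.absoluteGaloisGroup K, W.conjH1 p κ.kerSubgroup σ t - t ∈
      sharpFlatSelmerInfty W κ (closureEmb (K := K) (v₀.adicCompletion K)) ap g c col :=
    conjH1_sub_mem_of_conjH1_generator_sub_mem W κ hγ _
      (fun σ s hs ↦ conjH1_mem_sharpFlatSelmerInfty W κ _ ap g c col σ hs) htγ
  obtain ⟨y, hy⟩ := exists_sub_resOfLe_mem_sharpFlatSelmerInfty_of_cassels_top W κ ap g c col hκ S₀
    hgood htH htall hCas (hloc t htH htall) hv₀
  exact ⟨W.resOfLe p (le_top : κ.kerSubgroup ≤ ⊤) y, conjH1_resOfLe_top W κ γ y, hy⟩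

end Assembly

/-! ### «DIV in `H`» discharged: the three unconditional regimes of `InputsGreenbergSigmaDivAnyTorsion` -/

section Unconditional

variable {K : Type} [Field K] [NumberField K] (W : WeierstrassCurve K) [W.IsElliptic] {p : ℕ}
  [Fact p.Prime] (κ : ZpExtension K p) {v₀ : HeightOneSpectrum (𝓞 K)} (ap : ℤ)
  (g : Field.absoluteGaloisGroup (v₀.adicCompletion K)) (c : ℕ → localPoints W (v₀.adicCompletion K))
  (col : Chroma)

/-- **`(Sel^•(E/K_∞))_γ = 0` from CASSELS and the local lifts ALONE, `K` totally real (e.g. `ℚ`), EVERY `p`**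
(`κ` cyclotomic, `Sel_{p^∞}(E/K)` finite, `Σ₀` finite, any rational `p`-torsion): §1 with «DIV in `H`» the
theorem `InputsGreenbergSigmaDivAnyTorsion.forall_exists_conjH1_sub_eq_unramifiedOutside_real`.
[cite: GreenbergLNM1716, §4 Thm. 4.1, p. 119, Lemma 4.7 (pp. 107–108)] [cite: MilneADT2006, Ch. I, Thm. 4.10, Cor. 4.16] -/
theorem sharpFlatEndCoinvariants_subsingleton_of_cassels_top_real [IsTotallyReal K] (hκ : κ.IsCyclotomic)
    {γ : Field.absoluteGaloisGroup K} (hγ : κ.IsTopGenerator γ) (S₀ : Set (HeightOneSpectrum (𝓞 K)))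
    (hS₀ : S₀.Finite)
    (hgood : ∀ v : HeightOneSpectrum (𝓞 K), v ∉ S₀ → ((p : ℕ) : 𝓞 K) ∉ v.asIdeal →
      W.HasGoodReductionAt v)
    [Finite (W.selmerGroupPInfty p)] (hv₀ : ((p : ℕ) : 𝓞 K) ∈ v₀.asIdeal)
    (hle : sharpFlatSelmerInfty W κ (closureEmb (K := K) (v₀.adicCompletion K)) ap g c col ≤
      unramifiedOutside κ.kerSubgroup (W.geomPrimaryTorsion p) p S₀)
    (hCas : ∀ (x : ∀ v : HeightOneSpectrum (𝓞 K),
        discreteH1 (localSubgroup (⊤ : Subgroup (Field.absoluteGaloisGroup K)) (v.adicCompletion K))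
          (localPoints W (v.adicCompletion K)))
      (xi : ∀ w : InfinitePlace K,
        discreteH1 (localSubgroup (⊤ : Subgroup (Field.absoluteGaloisGroup K)) w.Completion)
          (localPoints W w.Completion)),
      (∀ v, ∃ k : ℕ, p ^ k • x v = 0) → (∀ w, ∃ k : ℕ, p ^ k • xi w = 0) →
      ∃ y : W.subgroupH1 p (⊤ : Subgroup (Field.absoluteGaloisGroup K)),
        y ∈ unramifiedOutside (⊤ : Subgroup (Field.absoluteGaloisGroup K)) (W.geomPrimaryTorsion p) p S₀ ∧
        (∀ v, (v ∈ S₀ ∨ ((p : ℕ) : 𝓞 K) ∈ v.asIdeal) →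
          W.localResOver p ⊤ (v.adicCompletion K) y = x v) ∧
        (∀ w, W.localResOver p ⊤ w.Completion y = xi w))
    (hloc : ∀ t ∈ unramifiedOutside κ.kerSubgroup (W.geomPrimaryTorsion p) p S₀,
      (∀ σ : Field.absoluteGaloisGroup K, W.conjH1 p κ.kerSubgroup σ t - t ∈
        sharpFlatSelmerInfty W κ (closureEmb (K := K) (v₀.adicCompletion K)) ap g c col) →
      ∀ v : HeightOneSpectrum (𝓞 K), (v ∈ S₀ ∨ ((p : ℕ) : 𝓞 K) ∈ v.asIdeal) →
      ∃ xv : discreteH1 (localSubgroup (⊤ : Subgroup (Field.absoluteGaloisGroup K)) (v.adicCompletion K))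
          (localPoints W (v.adicCompletion K)),
        (∃ k : ℕ, p ^ k • xv = 0) ∧
        ∀ y : W.subgroupH1 p (⊤ : Subgroup (Field.absoluteGaloisGroup K)),
          W.localResOver p ⊤ (v.adicCompletion K) y = xv →
          t - W.resOfLe p (le_top : κ.kerSubgroup ≤ ⊤) y ∈
              W.localKerOver p κ.kerSubgroup (v.adicCompletion K) ∧
          (v = v₀ → t - W.resOfLe p (le_top : κ.kerSubgroup ≤ ⊤) y ∈
            sharpFlatLocalKummerOverOfEmb W p κ.kerSubgroup (closureEmb (K := K) (v₀.adicCompletion K))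
              (localTowerPointsOfEmb κ (closureEmb (K := K) (v₀.adicCompletion K)) W)
              (colemanKer κ (closureEmb (K := K) (v₀.adicCompletion K)) W ap g c col))) :
    Subsingleton (EndCoinvariants
      (conjSharpFlatSelmerInfty W κ (closureEmb (K := K) (v₀.adicCompletion K)) ap g c col γ - 1)) :=
  sharpFlatEndCoinvariants_subsingleton_of_cassels_top_of_div W κ ap g c col hκ hγ S₀ hgood hv₀ hle
    (fun s hs ↦ InputsGreenbergSigmaDivAnyTorsion.forall_exists_conjH1_sub_eq_unramifiedOutside_real W p κ hκ
      hγ S₀ hS₀ hgood s hs) hCas hloc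

/-- **`(Sel^•(E/K_∞))_γ = 0` from CASSELS and the local lifts ALONE, ANY number field `K`, ODD `p`**
(`κ` cyclotomic, `Sel_{p^∞}(E/K)` finite, `Σ₀` finite): §1 with «DIV in `H`» the theorem
`InputsGreenbergSigmaDivAnyTorsion.forall_exists_conjH1_sub_eq_unramifiedOutside_odd`.
[cite: GreenbergLNM1716, §4 Thm. 4.1, p. 119, Lemma 4.7 (pp. 107–108)] [cite: MilneADT2006, Ch. I, Thm. 4.10 (a)] -/
theorem sharpFlatEndCoinvariants_subsingleton_of_cassels_top_odd (hp2 : p ≠ 2) (hκ : κ.IsCyclotomic)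
    {γ : Field.absoluteGaloisGroup K} (hγ : κ.IsTopGenerator γ) (S₀ : Set (HeightOneSpectrum (𝓞 K)))
    (hS₀ : S₀.Finite)
    (hgood : ∀ v : HeightOneSpectrum (𝓞 K), v ∉ S₀ → ((p : ℕ) : 𝓞 K) ∉ v.asIdeal →
      W.HasGoodReductionAt v)
    [Finite (W.selmerGroupPInfty p)] (hv₀ : ((p : ℕ) : 𝓞 K) ∈ v₀.asIdeal)
    (hle : sharpFlatSelmerInfty W κ (closureEmb (K := K) (v₀.adicCompletion K)) ap g c col ≤
      unramifiedOutside κ.kerSubgroup (W.geomPrimaryTorsion p) p S₀)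
    (hCas : ∀ (x : ∀ v : HeightOneSpectrum (𝓞 K),
        discreteH1 (localSubgroup (⊤ : Subgroup (Field.absoluteGaloisGroup K)) (v.adicCompletion K))
          (localPoints W (v.adicCompletion K)))
      (xi : ∀ w : InfinitePlace K,
        discreteH1 (localSubgroup (⊤ : Subgroup (Field.absoluteGaloisGroup K)) w.Completion)
          (localPoints W w.Completion)),
      (∀ v, ∃ k : ℕ, p ^ k • x v = 0) → (∀ w, ∃ k : ℕ, p ^ k • xi w = 0) →
      ∃ y : W.subgroupH1 p (⊤ : Subgroup (Field.absoluteGaloisGroup K)),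
        y ∈ unramifiedOutside (⊤ : Subgroup (Field.absoluteGaloisGroup K)) (W.geomPrimaryTorsion p) p S₀ ∧
        (∀ v, (v ∈ S₀ ∨ ((p : ℕ) : 𝓞 K) ∈ v.asIdeal) →
          W.localResOver p ⊤ (v.adicCompletion K) y = x v) ∧
        (∀ w, W.localResOver p ⊤ w.Completion y = xi w))
    (hloc : ∀ t ∈ unramifiedOutside κ.kerSubgroup (W.geomPrimaryTorsion p) p S₀,
      (∀ σ : Field.absoluteGaloisGroup K, W.conjH1 p κ.kerSubgroup σ t - t ∈
        sharpFlatSelmerInfty W κ (closureEmb (K := K) (v₀.adicCompletion K)) ap g c col) →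
      ∀ v : HeightOneSpectrum (𝓞 K), (v ∈ S₀ ∨ ((p : ℕ) : 𝓞 K) ∈ v.asIdeal) →
      ∃ xv : discreteH1 (localSubgroup (⊤ : Subgroup (Field.absoluteGaloisGroup K)) (v.adicCompletion K))
          (localPoints W (v.adicCompletion K)),
        (∃ k : ℕ, p ^ k • xv = 0) ∧
        ∀ y : W.subgroupH1 p (⊤ : Subgroup (Field.absoluteGaloisGroup K)),
          W.localResOver p ⊤ (v.adicCompletion K) y = xv →
          t - W.resOfLe p (le_top : κ.kerSubgroup ≤ ⊤) y ∈
              W.localKerOver p κ.kerSubgroup (v.adicCompletion K) ∧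
          (v = v₀ → t - W.resOfLe p (le_top : κ.kerSubgroup ≤ ⊤) y ∈
            sharpFlatLocalKummerOverOfEmb W p κ.kerSubgroup (closureEmb (K := K) (v₀.adicCompletion K))
              (localTowerPointsOfEmb κ (closureEmb (K := K) (v₀.adicCompletion K)) W)
              (colemanKer κ (closureEmb (K := K) (v₀.adicCompletion K)) W ap g c col))) :
    Subsingleton (EndCoinvariants
      (conjSharpFlatSelmerInfty W κ (closureEmb (K := K) (v₀.adicCompletion K)) ap g c col γ - 1)) :=
  sharpFlatEndCoinvariants_subsingleton_of_cassels_top_of_div W κ ap g c col hκ hγ S₀ hgood hv₀ hle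
    (fun s hs ↦ InputsGreenbergSigmaDivAnyTorsion.forall_exists_conjH1_sub_eq_unramifiedOutside_odd W p κ hp2
      hκ hγ S₀ hS₀ hgood s hs) hCas hloc

/-- **`(Sel^•(E/K_∞))_γ = 0` from CASSELS and the local lifts ALONE, `K` totally complex, EVERY `p`**
(`κ` cyclotomic, `Sel_{p^∞}(E/K)` finite, `Σ₀` finite): §1 with «DIV in `H`» the theorem
`InputsGreenbergSigmaDivAnyTorsion.forall_exists_conjH1_sub_eq_unramifiedOutside_complex`.
[cite: GreenbergLNM1716, §4 Thm. 4.1, p. 119, Lemma 4.7 (pp. 107–108)] [cite: MilneADT2006, Ch. I, Thm. 4.10 (a), Thm. 6.13 (c)] -/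
theorem sharpFlatEndCoinvariants_subsingleton_of_cassels_top_complex [IsTotallyComplex K]
    (hκ : κ.IsCyclotomic) {γ : Field.absoluteGaloisGroup K} (hγ : κ.IsTopGenerator γ)
    (S₀ : Set (HeightOneSpectrum (𝓞 K))) (hS₀ : S₀.Finite)
    (hgood : ∀ v : HeightOneSpectrum (𝓞 K), v ∉ S₀ → ((p : ℕ) : 𝓞 K) ∉ v.asIdeal →
      W.HasGoodReductionAt v)
    [Finite (W.selmerGroupPInfty p)] (hv₀ : ((p : ℕ) : 𝓞 K) ∈ v₀.asIdeal)
    (hle : sharpFlatSelmerInfty W κ (closureEmb (K := K) (v₀.adicCompletion K)) ap g c col ≤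
      unramifiedOutside κ.kerSubgroup (W.geomPrimaryTorsion p) p S₀)
    (hCas : ∀ (x : ∀ v : HeightOneSpectrum (𝓞 K),
        discreteH1 (localSubgroup (⊤ : Subgroup (Field.absoluteGaloisGroup K)) (v.adicCompletion K))
          (localPoints W (v.adicCompletion K)))
      (xi : ∀ w : InfinitePlace K,
        discreteH1 (localSubgroup (⊤ : Subgroup (Field.absoluteGaloisGroup K)) w.Completion)
          (localPoints W w.Completion)),
      (∀ v, ∃ k : ℕ, p ^ k • x v = 0) → (∀ w, ∃ k : ℕ, p ^ k • xi w = 0) →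
      ∃ y : W.subgroupH1 p (⊤ : Subgroup (Field.absoluteGaloisGroup K)),
        y ∈ unramifiedOutside (⊤ : Subgroup (Field.absoluteGaloisGroup K)) (W.geomPrimaryTorsion p) p S₀ ∧
        (∀ v, (v ∈ S₀ ∨ ((p : ℕ) : 𝓞 K) ∈ v.asIdeal) →
          W.localResOver p ⊤ (v.adicCompletion K) y = x v) ∧
        (∀ w, W.localResOver p ⊤ w.Completion y = xi w))
    (hloc : ∀ t ∈ unramifiedOutside κ.kerSubgroup (W.geomPrimaryTorsion p) p S₀,
      (∀ σ : Field.absoluteGaloisGroup K, W.conjH1 p κ.kerSubgroup σ t - t ∈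
        sharpFlatSelmerInfty W κ (closureEmb (K := K) (v₀.adicCompletion K)) ap g c col) →
      ∀ v : HeightOneSpectrum (𝓞 K), (v ∈ S₀ ∨ ((p : ℕ) : 𝓞 K) ∈ v.asIdeal) →
      ∃ xv : discreteH1 (localSubgroup (⊤ : Subgroup (Field.absoluteGaloisGroup K)) (v.adicCompletion K))
          (localPoints W (v.adicCompletion K)),
        (∃ k : ℕ, p ^ k • xv = 0) ∧
        ∀ y : W.subgroupH1 p (⊤ : Subgroup (Field.absoluteGaloisGroup K)),
          W.localResOver p ⊤ (v.adicCompletion K) y = xv →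
          t - W.resOfLe p (le_top : κ.kerSubgroup ≤ ⊤) y ∈
              W.localKerOver p κ.kerSubgroup (v.adicCompletion K) ∧
          (v = v₀ → t - W.resOfLe p (le_top : κ.kerSubgroup ≤ ⊤) y ∈
            sharpFlatLocalKummerOverOfEmb W p κ.kerSubgroup (closureEmb (K := K) (v₀.adicCompletion K))
              (localTowerPointsOfEmb κ (closureEmb (K := K) (v₀.adicCompletion K)) W)
              (colemanKer κ (closureEmb (K := K) (v₀.adicCompletion K)) W ap g c col))) :
    Subsingleton (EndCoinvariants
      (conjSharpFlatSelmerInfty W κ (closureEmb (K := K) (v₀.adicCompletion K)) ap g c col γ - 1)) :=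
  sharpFlatEndCoinvariants_subsingleton_of_cassels_top_of_div W κ ap g c col hκ hγ S₀ hgood hv₀ hle
    (fun s hs ↦ InputsGreenbergSigmaDivAnyTorsion.forall_exists_conjH1_sub_eq_unramifiedOutside_complex W p κ
      hκ hγ S₀ hS₀ hgood s hs) hCas hloc

end Unconditional

/-! ## §2 Door v8: COUNT♭@2 from the Honda₂ clauses alone -/

/-- **DOOR v8 — the COUNT♭@2 clause of `stub_allFlatData` from the Honda₂ clauses ALONE: no named fact, no
displayed input.** The statement of `SSFlatEC.flatCountTwo_of_print4` (door v7) with its four PRINT-by-name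
binders deleted: Prop. 4.13 (Cassels) over `ℚ` is `InputsPoitouTateSelmer.casselsSurjectivity_H1Sigma_holds ℚ`;
Prop. 4.12, the corank count pp. 119–120 and §5 p. 140 (Kato Thm. 12.4) are not needed — their joint use, «DIV in
`H¹(ℚ_Σ/ℚ_∞, E[2^∞])`», is `InputsGreenbergSigmaDivAnyTorsion.forall_exists_conjH1_sub_eq_unramifiedOutside_real`
(here through §1 `…_of_cassels_top_real`); p. 108 is `Greenberg1999.localQuotient_restriction_surjective_holds`;
the ♭-local lift at `2` is `SSFlatEC.hloc2_of_flatData`; Cassels' count is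
`SSFlatEC.natCard_flatKerG_eq_pow_of_casselsSurjectivity`; the two K3-shape clauses are GEN 10's
`apply_layer_zero_eq_zero_of_mem_colemanKer_flat` / `mem_localKerOver_of_flat_rat`.
[cite: GreenbergLNM1716, §4 Thm. 4.1, Lemma 4.7 (pp. 107–108), p. 119, Prop. 4.13 / p. 122]
[cite: Sprung2012, §7 Def. 7.9–7.11 (p. 1503)] -/
theorem flatCountTwo_noPrint (W : WeierstrassCurve ℚ) [W.IsElliptic] [W.IsGloballyMinimal]
    (hss : GoodSS W 2) (κ : ZpExtension ℚ 2) (hκ : κ.IsCyclotomic) {γ : Field.absoluteGaloisGroup ℚ}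
    (hγ : κ.IsTopGenerator γ) {v : HeightOneSpectrum (𝓞 ℚ)} (hv : (2 : 𝓞 ℚ) ∈ v.asIdeal)
    {g : Field.absoluteGaloisGroup (v.adicCompletion ℚ)} {c : ℕ → localPoints W (v.adicCompletion ℚ)}
    (hg : κ.IsTopGenerator (resGalOfEmb (closureEmb (K := ℚ) (v.adicCompletion ℚ)) g))
    (hc : ∀ n, c n ∈ localLayerPointsOfEmb κ (closureEmb (K := ℚ) (v.adicCompletion ℚ)) W n)
    (hTr : ∀ n, 1 ≤ n → localTraceOfEmb κ (closureEmb (K := ℚ) (v.adicCompletion ℚ)) W n (n + 1)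
      (c (n + 1)) = W.frobeniusTrace 2 • c n - c (n - 1))
    (hinj : ∀ z₀ : localLayerPointsOfEmb κ (closureEmb (K := ℚ) (v.adicCompletion ℚ)) W 0 →+ ℤ_[2],
      evalOn W (localLayerPointsOfEmb κ (closureEmb (K := ℚ) (v.adicCompletion ℚ)) W 0) z₀ (c 0) = 0 →
        z₀ = 0)
    (hsat : ∀ a : ℤ_[2],
      (∃ z₀ : localLayerPointsOfEmb κ (closureEmb (K := ℚ) (v.adicCompletion ℚ)) W 0 →+ ℤ_[2],
        evalOn W (localLayerPointsOfEmb κ (closureEmb (K := ℚ) (v.adicCompletion ℚ)) W 0) z₀ (c 0) =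
          2 * a) →
      ∃ y : localLayerPointsOfEmb κ (closureEmb (K := ℚ) (v.adicCompletion ℚ)) W 0 →+ ℤ_[2],
        evalOn W (localLayerPointsOfEmb κ (closureEmb (K := ℚ) (v.adicCompletion ℚ)) W 0) y (c 0) = a)
    (S₀ : Finset (HeightOneSpectrum (𝓞 ℚ)))
    (hgood : ∀ w : HeightOneSpectrum (𝓞 ℚ), w ∉ S₀ → ((2 : ℕ) : 𝓞 ℚ) ∉ w.asIdeal → W.HasGoodReductionAt w) :
    Finite (W.selmerGroupPInfty 2) →
      Finite (EndCoinvariants (conjSharpFlatSelmerInfty W κ (closureEmb (K := ℚ) (v.adicCompletion ℚ))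
        (W.frobeniusTrace 2) g c .flat γ - 1)) →
      Nat.card (↥((sharpFlatSelmerInfty W κ (closureEmb (K := ℚ) (v.adicCompletion ℚ))
            (W.frobeniusTrace 2) g c .flat).comap (W.layerToInfty κ 0)) ⧸
          (W.selmerLayer κ 0).addSubgroupOf
            ((sharpFlatSelmerInfty W κ (closureEmb (K := ℚ) (v.adicCompletion ℚ))
              (W.frobeniusTrace 2) g c .flat).comap (W.layerToInfty κ 0))) *
        Nat.card (MulAction.fixedPoints (Field.absoluteGaloisGroup ℚ) (W.geomPrimaryTorsion 2)) =
      2 ^ (padicValNat 2 W.tamagawaProduct) *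
        Nat.card (EndCoinvariants (conjSharpFlatSelmerInfty W κ
          (closureEmb (K := ℚ) (v.adicCompletion ℚ)) (W.frobeniusTrace 2) g c .flat γ - 1)) := by
  -- `#E(ℚ)[2^∞] = 1` at a good supersingular `2`
  have htors : Nat.card (MulAction.fixedPoints (Field.absoluteGaloisGroup ℚ) (W.geomPrimaryTorsion 2)) = 1 := by
    refine W.natCard_fixedPoints_absoluteGaloisGroup_geomPrimaryTorsion_eq_one (p := 2) fun P hP ↦ ?_
    have h := (irr_two_iff_forall_two_nsmul W).mp
      (Summit.BirchSwinnertonDyer.Rank1Residual.P2.irr_two_of_goodSS_two W hss) P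
    apply h
    convert hP
  -- good reduction at the place `v ∋ 2`
  have hv' : ((2 : ℕ) : 𝓞 ℚ) ∈ v.asIdeal := by exact_mod_cast hv
  have hgoodv : W.HasGoodReductionAt v :=
    (hasGoodReductionAtPrime_primesEquiv_iff_holds W v 2
      (Literature.NumberTheory.GaloisRepresentations.LocalField.primesEquiv_eq_of_natCast_mem 2 v hv')).mp hss.1
  have hgood' : ∀ w : HeightOneSpectrum (𝓞 ℚ), w ∉ (↑S₀ : Set (HeightOneSpectrum (𝓞 ℚ))) →
      ((2 : ℕ) : 𝓞 ℚ) ∉ w.asIdeal → W.HasGoodReductionAt w :=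
    fun w hw hpw ↦ hgood w (fun h ↦ hw (Finset.mem_coe.mpr h)) hpw
  -- Lemma 2.3 at `2` and the two K3-shape `♭`-clauses from the Honda₂ clauses (GEN 10)
  have hnt : ∀ P ∈ localTowerPointsOfEmb κ (closureEmb (K := ℚ) (v.adicCompletion ℚ)) W, 2 • P = 0 → P = 0 :=
    fun P hP h2 ↦ eq_zero_of_mem_localTowerPointsOfEmb_of_two_nsmul W hss κ hv _ hP h2
  have h𝒦 : ∀ z ∈ colemanKer κ (closureEmb (K := ℚ) (v.adicCompletion ℚ)) W (W.frobeniusTrace 2) g c .flat,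
      ∀ (x : localPoints W (v.adicCompletion ℚ))
        (hx : x ∈ localLayerPointsOfEmb κ (closureEmb (K := ℚ) (v.adicCompletion ℚ)) W 0),
        z ⟨x, localLayerPointsOfEmb_le_localTowerPointsOfEmb κ _ W 0 hx⟩ = 0 :=
    fun z hz x hx ↦ apply_layer_zero_eq_zero_of_mem_colemanKer_flat (hc 0) hinj hz hx
  have hrp : ∀ y : W.subgroupH1 2 (κ.layerSubgroup 0),
      W.layerToInfty κ 0 y ∈ sharpFlatLocalKummerOverOfEmb W 2 κ.kerSubgroup
          (closureEmb (K := ℚ) (v.adicCompletion ℚ))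
          (localTowerPointsOfEmb κ (closureEmb (K := ℚ) (v.adicCompletion ℚ)) W)
          (colemanKer κ (closureEmb (K := ℚ) (v.adicCompletion ℚ)) W (W.frobeniusTrace 2) g c .flat) →
        y ∈ W.localKerOver 2 (κ.layerSubgroup 0) (v.adicCompletion ℚ) :=
    fun y hy ↦ mem_localKerOver_of_flat_rat W 2 κ hv hnt hss.2 hg hc hTr hinj hsat y hy
  -- Prop. 4.13 (Cassels) over `ℚ`: a tree theorem
  have hC : Greenberg1999.casselsSurjectivity_H1Sigma ℚ := InputsPoitouTateSelmer.casselsSurjectivity_H1Sigma_holds ℚ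
  -- `Sel♭_∞ ≤ Sel_∞ ≤ 𝒦_w` at every finite `w`
  have hSelle : ∀ w : HeightOneSpectrum (𝓞 ℚ),
      sharpFlatSelmerInfty W κ (closureEmb (K := ℚ) (v.adicCompletion ℚ)) (W.frobeniusTrace 2) g c .flat ≤
        W.localKerOver 2 κ.kerSubgroup (w.adicCompletion ℚ) := fun w s hs ↦ by
    have h1 := ((W.mem_selmerGroupOver_iff 2 κ.kerSubgroup s).1
      (sharpFlatSelmerInfty_le_selmerInfty W κ _ _ g c .flat hs)).1 w 1
    have hone : W.conjH1 2 κ.kerSubgroup 1 = AddMonoidHom.id _ :=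
      conjH1_of_mem_holds κ.kerSubgroup _ (one_mem _)
    rwa [hone, AddMonoidHom.id_apply] at h1
  refine flatCountTwo_of_cassels_of_coinv W hss κ γ g c (fun hSel ↦ ?_) (fun hSel _ ↦ ?_)
  · -- Cassels' count
    exact natCard_flatKerG_eq_pow_of_casselsSurjectivity W κ (W.frobeniusTrace 2) g c .flat hC hκ hv' hgoodv
      h𝒦 hrp hSel htors
  · -- COINV♭: §1 (totally real base `ℚ`) with Cassels (tree theorem) and the local lifts (p. 108 theorem
    -- away from `2`, `hloc2_of_flatData` at `2`)
    haveI := hSel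
    haveI := sharpFlatEndCoinvariants_subsingleton_of_cassels_top_real W κ (W.frobeniusTrace 2) g c .flat hκ
      hγ (↑S₀ : Set (HeightOneSpectrum (𝓞 ℚ))) S₀.finite_toSet hgood' hv'
      (sharpFlatSelmerInfty_le_unramifiedOutside W κ (closureEmb (K := ℚ) (v.adicCompletion ℚ))
        (W.frobeniusTrace 2) g c .flat _ hgood')
      (fun x xi hx hxi ↦ hC W 2 hSel htors (↑S₀) (Finset.finite_toSet S₀) hgood' x xi hx hxi)
      (fun t ht hconj w _ ↦ by
        by_cases h2 : ((2 : ℕ) : 𝓞 ℚ) ∈ w.asIdeal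
        · exact hloc2_of_flatData W hss κ hv hg hc hTr hinj S₀ t ht hconj w h2
        · -- `w ∤ 2`: Greenberg p. 108 (tree theorem); the `♭`-clause is vacuous
          obtain ⟨xw, hx, hmain⟩ := exists_localLift_of_localSurj W κ
            (Greenberg1999.localQuotient_restriction_surjective_holds W 2 κ hκ w h2) _ (hSelle w) t hconj
          refine ⟨xw, hx, fun y hy ↦ ⟨hmain y hy, fun hwv ↦ absurd ?_ h2⟩⟩
          rw [hwv]
          exact_mod_cast hv)
    exact Nat.card_unique

end Summit.BirchSwinnertonDyer.BirchSwinnertonDyer.Theorems.InputsGreenbergFlatCountTwo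

end
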